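import Summits.HubbardSuperconductivity.HubbardSuperconductivity.Theorems.WeakCouplingBCSKlLindhardEnclosureCornerMean
import Mathlib.Analysis.SpecialFunctions.Trigonometric.Deriv

/-!
# KL-MARGIN-SCAN reader (22) «kernel-lindhard-enclosure» — SLICE REGULARITY of the band difference (the hypotheses of the corner-mean lemma)

Second generic brick for the square-cell rules (chord ceiling, Jensen floor): along every horizontal or vertical line the band difference
`g(x, y) = ε_{t′}(x + q₁, y + q₂) − ε_{t′}(x, y)` (`ε_{t′}(x,y) = −2(cos x + cos y) − 4t′ cos x cos y`) is a trigonometric affine form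
`A + B·cos(s + q) + C·cos s` with `|B| + |C| ≤ 4(1 + 2|t′|)`; such forms are `C²` with second derivative `−B cos(s+q) − C cos s`, bounded by
`|B| + |C|`; and for `a < b` the within-interval second derivative `iteratedDerivWithin 2 · (uIcc a b)` is bounded by the same constant at
EVERY real point (it vanishes off the closed interval).  Net: `bandDiffFn_slice_y_bound` / `bandDiffFn_slice_x_bound` deliver exactly the
`ContDiffOn` + `∀ t, |iteratedDerivWithin 2 …| ≤ 4(1+2|t′|)` hypotheses of `corner_mean_error_le`, i.e. the kernel's `interpE` constant.
Honest framing: elementary calculus; nothing in this file asserts a KL margin at any `t′ ≠ 0`, `K₃`, `U₀`, the window or B1g dominance; a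
Kohn–Luttinger instability statement is not ODLRO and nothing here proves superconductivity in the Hubbard model.  (p1 g25, 2026-08-29.)
-/

noncomputable section

set_option linter.dupNamespace false

namespace Summit.HubbardSuperconductivity.HubbardSuperconductivity.Theorems.KlLindhardEnclosure

open Real Set

/-! ## §1 Trigonometric affine forms `A + B cos(s+q) + C cos s` -/

/-- First derivative of `s ↦ A + B cos(s+q) + C cos s`. -/
theorem hasDerivAt_trigAff (A B C q s : ℝ) :
    HasDerivAt (fun s => A + B * Real.cos (s + q) + C * Real.cos s) (-B * Real.sin (s + q) - C * Real.sin s) s := by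
  have h1 : HasDerivAt (fun s => Real.cos (s + q)) (-Real.sin (s + q) * 1) s := ((hasDerivAt_id s).add_const q).cos
  have h2 : HasDerivAt (fun s => Real.cos s) (-Real.sin s) s := Real.hasDerivAt_cos s
  have h := ((h1.const_mul B).const_add A).add (h2.const_mul C)
  exact h.congr_deriv (by ring)

/-- Second derivative of `s ↦ A + B cos(s+q) + C cos s`. -/
theorem hasDerivAt_trigAff' (B C q s : ℝ) :
    HasDerivAt (fun s => -B * Real.sin (s + q) - C * Real.sin s) (-B * Real.cos (s + q) - C * Real.cos s) s := by
  have h1 : HasDerivAt (fun s => Real.sin (s + q)) (Real.cos (s + q) * 1) s := ((hasDerivAt_id s).add_const q).sin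
  have h2 : HasDerivAt (fun s => Real.sin s) (Real.cos s) s := Real.hasDerivAt_sin s
  have h := (h1.const_mul (-B)).sub (h2.const_mul C)
  exact h.congr_deriv (by ring)

/-- `deriv` of the affine form. -/
theorem deriv_trigAff (A B C q : ℝ) :
    deriv (fun s => A + B * Real.cos (s + q) + C * Real.cos s) = fun s => -B * Real.sin (s + q) - C * Real.sin s := by
  funext s; exact (hasDerivAt_trigAff A B C q s).deriv

/-- Second `deriv` of the affine form. -/
theorem deriv_deriv_trigAff (A B C q s : ℝ) :
    deriv (deriv (fun s => A + B * Real.cos (s + q) + C * Real.cos s)) s = -B * Real.cos (s + q) - C * Real.cos s := by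
  rw [deriv_trigAff]; exact (hasDerivAt_trigAff' B C q s).deriv

/-- The affine form is `C²` (indeed smooth). -/
theorem contDiff_trigAff (A B C q : ℝ) : ContDiff ℝ 2 (fun s => A + B * Real.cos (s + q) + C * Real.cos s) := by
  fun_prop

/-- The second derivative of the affine form is bounded by `|B| + |C|`. -/
theorem abs_deriv_deriv_trigAff_le (A B C q s : ℝ) :
    |deriv (deriv (fun s => A + B * Real.cos (s + q) + C * Real.cos s)) s| ≤ |B| + |C| := by
  rw [deriv_deriv_trigAff]
  have h1 := Real.abs_cos_le_one (s + q)
  have h2 := Real.abs_cos_le_one s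
  calc |-B * Real.cos (s + q) - C * Real.cos s| ≤ |-B * Real.cos (s + q)| + |C * Real.cos s| := abs_sub _ _
    _ = |B| * |Real.cos (s + q)| + |C| * |Real.cos s| := by rw [abs_mul, abs_mul, abs_neg]
    _ ≤ |B| * 1 + |C| * 1 := add_le_add (mul_le_mul_of_nonneg_left h1 (abs_nonneg _)) (mul_le_mul_of_nonneg_left h2 (abs_nonneg _))
    _ = |B| + |C| := by ring

/-! ## §2 From a global second-derivative bound to the within-interval bound used by the trapezoidal rule -/

/-- For `a < b` and `φ ∈ C²(ℝ)` with `|φ''| ≤ ζ` everywhere (`0 ≤ ζ`), the within-`uIcc a b` second derivative is bounded by `ζ` at EVERY real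
point (inside: it is `φ''`; outside the closed interval: it is `0`). -/
theorem abs_iteratedDerivWithin_two_le {φ : ℝ → ℝ} {a b ζ : ℝ} (hab : a < b) (hφ : ContDiff ℝ 2 φ) (hζ : 0 ≤ ζ)
    (hb : ∀ s, |deriv (deriv φ) s| ≤ ζ) (t : ℝ) : |iteratedDerivWithin 2 φ (uIcc a b) t| ≤ ζ := by
  by_cases ht : t ∈ uIcc a b
  · have hud : UniqueDiffOn ℝ (uIcc a b) := by rw [uIcc_of_le hab.le]; exact uniqueDiffOn_Icc hab
    rw [iteratedDerivWithin_eq_iteratedDeriv hud hφ.contDiffAt ht, iteratedDeriv_eq_iterate]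
    simpa using hb t
  · have hcl : t ∉ closure (uIcc a b) := by rwa [uIcc_of_le hab.le, closure_Icc] at *
    have : iteratedDerivWithin 2 φ (uIcc a b) t = 0 := by
      rw [show (2 : ℕ) = 1 + 1 from rfl, iteratedDerivWithin_succ]
      exact derivWithin_zero_of_notMem_closure hcl
    rw [this, abs_zero]; exact hζ

/-- The packaged form for affine trigonometric slices: `C²` on `uIcc a b` and `|∂²| ≤ |B| + |C|` there, for `a < b`. -/
theorem trigAff_slice_bound (A B C q : ℝ) {a b : ℝ} (hab : a < b) :
    ContDiffOn ℝ 2 (fun s => A + B * Real.cos (s + q) + C * Real.cos s) (uIcc a b) ∧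
    ∀ t, |iteratedDerivWithin 2 (fun s => A + B * Real.cos (s + q) + C * Real.cos s) (uIcc a b) t| ≤ |B| + |C| :=
  ⟨(contDiff_trigAff A B C q).contDiffOn,
    abs_iteratedDerivWithin_two_le hab (contDiff_trigAff A B C q) (by positivity) (abs_deriv_deriv_trigAff_le A B C q)⟩

/-! ## §3 The band difference of the kernel -/

/-- The band difference along the transfer `q = (q₁, q₂)`: `g(x,y) = ε_{t′}(x+q₁, y+q₂) − ε_{t′}(x, y)` with `ε_{t′}(x,y) = −2(cos x + cos y) − 4t′ cos x cos y`
(real coordinates; `t′` real). -/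
def bandDiffFn (t' q1 q2 x y : ℝ) : ℝ :=
  (-2 * (Real.cos (x + q1) + Real.cos (y + q2)) - 4 * t' * Real.cos (x + q1) * Real.cos (y + q2)) -
    (-2 * (Real.cos x + Real.cos y) - 4 * t' * Real.cos x * Real.cos y)

/-- A vertical slice of `g` is a trigonometric affine form in `y`. -/
theorem bandDiffFn_slice_y (t' q1 q2 x : ℝ) :
    (fun y => bandDiffFn t' q1 q2 x y) = fun y => (-2 * Real.cos (x + q1) + 2 * Real.cos x) +
      (-(2 + 4 * t' * Real.cos (x + q1))) * Real.cos (y + q2) + (2 + 4 * t' * Real.cos x) * Real.cos y := by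
  funext y; unfold bandDiffFn; ring

/-- A horizontal slice of `g` is a trigonometric affine form in `x`. -/
theorem bandDiffFn_slice_x (t' q1 q2 y : ℝ) :
    (fun x => bandDiffFn t' q1 q2 x y) = fun x => (-2 * Real.cos (y + q2) + 2 * Real.cos y) +
      (-(2 + 4 * t' * Real.cos (y + q2))) * Real.cos (x + q1) + (2 + 4 * t' * Real.cos y) * Real.cos x := by
  funext x; unfold bandDiffFn; ring

/-- The coefficient bound `|B| + |C| ≤ 4(1 + 2|t′|)` for the slices. -/
theorem slice_coeff_bound (t' u v : ℝ) :
    |(-(2 + 4 * t' * Real.cos u))| + |2 + 4 * t' * Real.cos v| ≤ 4 * (1 + 2 * |t'|) := by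
  have h1 := Real.abs_cos_le_one u
  have h2 := Real.abs_cos_le_one v
  have e1 : |(-(2 + 4 * t' * Real.cos u))| ≤ 2 + 4 * |t'| := by
    rw [abs_neg]
    calc |2 + 4 * t' * Real.cos u| ≤ |(2 : ℝ)| + |4 * t' * Real.cos u| := abs_add_le _ _
      _ = 2 + 4 * |t'| * |Real.cos u| := by rw [abs_mul, abs_mul]; norm_num
      _ ≤ 2 + 4 * |t'| * 1 := by nlinarith [abs_nonneg t']
      _ = 2 + 4 * |t'| := by ring
  have e2 : |2 + 4 * t' * Real.cos v| ≤ 2 + 4 * |t'| := by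
    calc |2 + 4 * t' * Real.cos v| ≤ |(2 : ℝ)| + |4 * t' * Real.cos v| := abs_add_le _ _
      _ = 2 + 4 * |t'| * |Real.cos v| := by rw [abs_mul, abs_mul]; norm_num
      _ ≤ 2 + 4 * |t'| * 1 := by nlinarith [abs_nonneg t']
      _ = 2 + 4 * |t'| := by ring
  linarith

/-- **VERTICAL SLICES**: for `a < b` and every `x`, `y ↦ g(x,y)` is `C²` on `uIcc a b` with within-second-derivative bounded by `4(1+2|t′|)` everywhere. -/
theorem bandDiffFn_slice_y_bound (t' q1 q2 : ℝ) {a b : ℝ} (hab : a < b) (x : ℝ) :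
    ContDiffOn ℝ 2 (fun y => bandDiffFn t' q1 q2 x y) (uIcc a b) ∧
    ∀ t, |iteratedDerivWithin 2 (fun y => bandDiffFn t' q1 q2 x y) (uIcc a b) t| ≤ 4 * (1 + 2 * |t'|) := by
  rw [bandDiffFn_slice_y]
  obtain ⟨h1, h2⟩ := trigAff_slice_bound (-2 * Real.cos (x + q1) + 2 * Real.cos x) (-(2 + 4 * t' * Real.cos (x + q1)))
    (2 + 4 * t' * Real.cos x) q2 hab
  exact ⟨h1, fun t => (h2 t).trans (slice_coeff_bound t' (x + q1) x)⟩

/-- **HORIZONTAL SLICES**: for `a < b` and every `y`, `x ↦ g(x,y)` is `C²` on `uIcc a b` with within-second-derivative bounded by `4(1+2|t′|)` everywhere. -/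
theorem bandDiffFn_slice_x_bound (t' q1 q2 : ℝ) {a b : ℝ} (hab : a < b) (y : ℝ) :
    ContDiffOn ℝ 2 (fun x => bandDiffFn t' q1 q2 x y) (uIcc a b) ∧
    ∀ t, |iteratedDerivWithin 2 (fun x => bandDiffFn t' q1 q2 x y) (uIcc a b) t| ≤ 4 * (1 + 2 * |t'|) := by
  rw [bandDiffFn_slice_x]
  obtain ⟨h1, h2⟩ := trigAff_slice_bound (-2 * Real.cos (y + q2) + 2 * Real.cos y) (-(2 + 4 * t' * Real.cos (y + q2)))
    (2 + 4 * t' * Real.cos y) q1 hab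
  exact ⟨h1, fun t => (h2 t).trans (slice_coeff_bound t' (y + q2) y)⟩

end Summit.HubbardSuperconductivity.HubbardSuperconductivity.Theorems.KlLindhardEnclosure

end
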